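import Literature.AlgebraicGeometry.Shioda1982.ExceptionalQuadruplesComplete
import HarnessLib

/-!
# Shioda 1982 / Meyer–Neutsch 1981: no exceptional quadruple at the level `N = 198` (kernel sweep above Aoki's bound `180`)

Topic `Literature/AlgebraicGeometry/Shioda1982`; companion of `ExceptionalQuadruplesComplete.lean` (search `checkB`, soundness
`tabelleOneCompleteAt_of_chunks`, invariant form `exists_mem_reps_of_isExceptionalQuadruple`, statement `TabelleOneCompleteAt`; sources,
method and framing in its module docstring) and of the series `ExceptionalQuadruplesSweep*.lean` (together: every level `2 ≤ N ≤ 180`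
that is not a row of Tabelle 1). THEOREMS only (no definition, no named fact): the same kernel search at the single level `N = 198`,
which carries NO row of [MeyerNeutsch1981Fermatquadrupel, Tabelle 1] (computer-generated there, "alle Fermatquadrupel für N ≤ 614
ermittelt", §2 p. 53) and lies above the range `N ≤ 180` of Shioda's table p. 727 — by Aoki's Theorem C ([Aoki1983], computer-assisted
for `181 ≤ m ≤ 672`) there is no exceptional element at any level `> 180`; this file makes the instance `N = 198` a kernel statement:
`completeAt_oneHundredNinetyEight` (every sorted pair-free primitive Hodge 4-multiset mod `198` is standard) and `not_isExceptionalQuadruple_oneHundredNinetyEight`.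
WHY THIS LEVEL (cell `pub-hfermat`): `198 = 18·11`: the residual instance `p = 11` of `exceptional_eighteenPrime` (`PicardNumberEighteenPrime.lean`), below the range `p ≥ 17` of `classify_hodgeMultiset_eighteenPrime`. `decide +kernel` only (no `native_decide`), chunked by first entries to bound the memory of
a single kernel evaluation (11 chunks; this file visits 220539 candidate triples, `φ(198) − 1 = 59` units each).

HONEST FRAMING (cell `pub-hfermat`): explicit algebraic cycles for specific Hodge classes on Fermat/Delsarte varieties; residual open
instances listed; no claim on general Hodge. These classes are algebraic (Lefschetz (1,1)); certified here is only the emptiness of the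
exceptional list at this level.

## References
* [MeyerNeutsch1981Fermatquadrupel] W. Meyer, W. Neutsch, *Fermatquadrupel*, Math. Ann. 256 (1981) 51–62, §2 p. 53, Tabelle 1 p. 54 (no row 198).
* [Shioda1982PicardFermat] T. Shioda, J. Fac. Sci. Univ. Tokyo IA 28 (1982) 725–734, table p. 727 (levels `≤ 180`), Prop. 4 (Q′) p. 729.
* [Aoki1983] N. Aoki, Math. Ann. 266 (1983) 23–54, Thm. C.
-/

namespace Literature.AlgebraicGeometry.Shioda1982

open Literature.AlgebraicGeometry.HodgeTheory

set_option maxHeartbeats 0 in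
/-- **Tabelle 1 is complete at `N = 198`, where it is empty**: every sorted Hodge 4-multiset mod `198` without a pair and with
`gcd = 1` is standard. Kernel exhaustion (`checkB`, 11 chunks of first entries, 220539 candidate triples).
[cite: MeyerNeutsch1981Fermatquadrupel, §2 p. 53 ("alle Fermatquadrupel für N ≤ 614 ermittelt") and Tabelle 1 p. 54 (no row 198)]
[cite: Aoki1983, Thm. C] [cite: Shioda1982PicardFermat, Prop. 4 (Q′) p. 729] -/
theorem completeAt_oneHundredNinetyEight : TabelleOneCompleteAt 198 :=
  tabelleOneCompleteAt_of_chunks 198 [(0, 6), (6, 6), (12, 6), (18, 6), (24, 6), (30, 6), (36, 6), (42, 7), (49, 8), (57, 12), (69, 129)] (by decide +kernel) (by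
    intro p hp
    simp only [List.mem_cons, List.not_mem_nil, or_false] at hp
    rcases hp with rfl | rfl | rfl | rfl | rfl | rfl | rfl | rfl | rfl | rfl | rfl <;> decide +kernel)

/-- **No exceptional quadruple ("Ausnahmequadrupel") at the level `198`** (`tabelleOne 198 = []`).
[cite: MeyerNeutsch1981Fermatquadrupel, Tabelle 1 p. 54 (no row 198)] [cite: Aoki1983, Thm. C] -/
theorem not_isExceptionalQuadruple_oneHundredNinetyEight (s : Multiset (ZMod 198)) : ¬ IsExceptionalQuadruple 198 s := by
  intro hs
  obtain ⟨r, hr, -⟩ := exists_mem_reps_of_isExceptionalQuadruple completeAt_oneHundredNinetyEight hs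
  simp [reps, tabelleOne] at hr

end Literature.AlgebraicGeometry.Shioda1982
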